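import Mathlib.GroupTheory.Commutator.Basic
import Mathlib.GroupTheory.Index
import Mathlib.GroupTheory.QuotientGroup.Defs
import Mathlib.Topology.Algebra.Group.Basic
import Mathlib.Topology.Algebra.ContinuousMonoidHom
import Mathlib.Algebra.Group.Subgroup.Pointwise
import Mathlib.Data.ZMod.Defs
import Mathlib.Data.Nat.GCD.Basic
import Mathlib.Tactic.Linarith
import Literature.AnabelianGeometry.AbsoluteAnabelian.FundamentalExtension
import HarnessLib

/-!
# [IUTchI] §1 Complements on Coverings of Punctured Elliptic Curves (kurims pp. 37–43)

Mochizuki, *Inter-universal Teichmüller theory I: construction of Hodge theaters*, kurims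
manuscript (May 2020), §1, pp. 37–43 ([IUTchI] §1 pp.37-43) [claim: Mochizuki2012, status: disputed]
(D-0012 claim key;
series status DISPUTED — nothing here is asserted; printed claims are `Prop`-valued PREDICATES on
explicit data, the constructions are honest group-theoretic definitions).

THE SETUP (p. 37) AS DATA.  `l ≥ 5` an integer prime to `6`; `X` a hyperbolic curve of type
`(1,1)` over a field `k` of characteristic zero; `C̲` a hyperbolic orbicurve of type `(1,l-tors)_±`
([EtTh] Def. 2.1) whose `k`-core `C` is also a `k`-core of `X`; `X̲ := C̲ ×_C X`; the cartesian
diagrams of open immersions `Π_X̲ ↪ Π_X`, `Π_C̲ ↪ Π_C` of arithmetic fundamental groups over `G_k`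
with geometric parts `Δ_(−)`; assumption (∗) "the natural action of `G_k` on `Δ_X^{ab} ⊗ (ℤ/lℤ)` is
trivial"; the zero cusp `ε⁰` of `X̲`, a nonzero cusp `ε̲` of `C̲` and the two cusps `ε′, ε″` of `X̲`
over
it, the cusp `2ε̲`, and decomposition groups of cusps — all étale-π₁-of-curves input (INTERFACE,
seat abc-iut-L4-t1, TODO-merge), entering as the structure `PuncturedEllipticData` built on the
tree's `FundamentalExtension` (`Π_C ↠ G_k`, seat abc-iut-L4-t1): everything lives inside ONE
profinite group `Π_C` with its surjection to `G_k`.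

THE CONSTRUCTION (pp. 37–38) AS DEFINITIONS inside `Π_C`: `Δ_X̲ ↠ Δ_X̲^{ab} ⊗ ℤ/l ↠ Δ_ε` (kill
commutators, `l`-th powers, and the inertia groups of the nonzero cusps `≠ ε′, ε″`) — kernels
`modLKer ≤ deltaEpsKer`; the involution `ι ∈ Gal(X̲/C̲)` acts on `Δ_ε` through conjugation by
`Δ_C̲ ∖ Δ_X̲`, and `Δ_ε ↠ Δ_ε⁺` kills the `(−1)`-eigenspace, i.e. the commutators `x c x⁻¹ c⁻¹`
(`x ∈ Δ_X̲`, `c ∈ Δ_C̲ ∖ Δ_X̲`) — kernel `jKer`, so `J_X = Π_X̲ / jKer ⊆ J_C = Π_C̲ / jKer`; the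
section
`σ : G_k → J_C` is the image of the decomposition group `D_{2ε}` (its inertia dies in `Δ_ε`), so
`Π_{X→} :=` (inverse image of `Im σ`) `= D_{2ε} · jKer` — `piXarrow`; `Gal(X̲/C̲) ⊆ Δ_C̲/jKer ≅
ℤ/2l` is
the subgroup of `l`-th powers, so `Π_{C→} :=` (inverse image of `Im σ × Gal(X̲/C̲)`)
`= D_{2ε} · jKer · (Δ_C̲)^l` — `piCarrow`.  (Products of subgroups are typed as joins `⊔`; they are
products once the printed normality claims hold.)

THE PRINTED CLAIMS (pp. 37–38: the exact sequence `0 → I_{ε′} × I_{ε″} → Δ_ε → Δ_E ⊗ ℤ/l → 0`,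
the eigenspace decomposition, `I_{ε′} ⥲ Δ_ε⁺`, the quotients `J_X ⊆ J_C`, `σ` a section with normal
image inside `J_X`, the cartesian diagram, `Gal(C→/C̲) ≅ ℤ/l`, `Gal(X̲/C̲) ≅ ℤ/2`,
`Gal(X→/C̲) ≅ ℤ/2l`) — predicate `ArrowCoveringClaims`; Definition 1.1 — `IsOfTypeOneLTorsArrow`,
`IsOfTypeOneLTorsArrowPM` (group-level shadow); Remark 1.1.2 — `piXarrow`/`piCarrow` ARE functions
of the data `(X/k, C̲, ε̲)`; Corollary 1.2 — `CharacteristicNatureOfCoverings` (extensional form);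
Remark 1.2.1 — `Rmk121`; Remark 1.2.3 (iii), last sentence — `rmk123iii_equalities_iff` (PROVED).

Deliberately NOT here: Remark 1.1.1 (prose); the curve-level form of Definition 1.1 (needs
hyperbolic orbicurves, TODO-merge abc-iut-L4-t1); Remarks 1.2.2 (i), (ii), 1.2.3 (i), (ii),
(iv)–(vii), which AMEND the texts of [AbsAnab] Lem. 1.3.9, [AbsTopI] Lem. 4.5 (iv), [CombGC]
Def. 1.4 (v)(vi), Rmk. 1.4.2–1.4.4 and the proof of [CombGC] Thm. 1.6 — typed where those items
are typed (seats abc-iut-L4-t4, abc-iut-L3-t4; INBOX note with the locators pp. 40–43).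
No printed statement is strengthened.
-/

namespace Literature.IUT.HodgeTheaters

open Pointwise Topology Literature.AnabelianGeometry.AbsoluteAnabelian

universe u

/-! ### The data of §1 (p. 37) -/

/-- INTERFACE DATA (TODO-merge:abc-iut-L4-t1), IUTchI §1 p. 37: inside the arithmetic fundamental
group `Π_C` of the `k`-core `C` (with `Π_C ↠ G_k`), the open subgroups `Π_X` (type `(1,1)`),
`Π_C̲` (type `(1,l-tors)_±`), hence `Π_X̲ = Π_X ∩ Π_C̲`; the integer `l`; the cusps of `X̲` with
representative decomposition groups `D_x ⊆ Π_X̲` (inertia groups `I_x = D_x ∩ Δ`); the zero cusp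
`ε⁰`, the cusps `ε′ ≠ ε″` over the nonzero cusp `ε̲` of `C̲`, and a cusp of `X̲` over the cusp `2ε̲`
of
`C̲`.  The `Prop` fields are printed standing hypotheses, not theorems. ([IUTchI] §1 p.37) [claim:
Mochizuki2012, status: disputed] -/
structure PuncturedEllipticData : Type (u + 1) where
  /-- `l ≥ 5`, an integer prime to `6` -/
  l : ℕ
  five_le : 5 ≤ l
  coprime_six : Nat.Coprime l 6
  /-- `Π_C ↠ G_k`: the arithmetic fundamental extension of the `k`-core `C` (the tree's interface
  `FundamentalExtension` of seat abc-iut-L4-t1: profinite `Π`, `G`, continuous surjective `aug`) -/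
  E : FundamentalExtension.{u}
  /-- the open subgroups `Π_X`, `Π_C̲` of `Π_C` (the finite étale coverings `X → C`, `C̲ → C`);
  `[Π_C : Π_X] = 2`; `X`, `C̲` geometrically connected over `k` -/
  PiX : Subgroup E.arith
  PiCbar : Subgroup E.arith
  isOpen_piX : IsOpen (PiX : Set E.arith)
  isOpen_piCbar : IsOpen (PiCbar : Set E.arith)
  index_piX : PiX.index = 2
  aug_piX : Function.Surjective (E.aug.toMonoidHom.comp PiX.subtype)
  aug_piCbar : Function.Surjective (E.aug.toMonoidHom.comp PiCbar.subtype)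
  /-- (∗): `G_k` acts trivially on `Δ_X^{ab} ⊗ ℤ/l`, i.e. `Π_X` acts trivially by conjugation on
  `Δ_X = Π_X ∩ Δ_C` modulo the closure of commutators and `l`-th powers -/
  star : ∀ g ∈ PiX, ∀ x ∈ PiX ⊓ E.geom,
    g * x * g⁻¹ * x⁻¹ ∈ (⁅PiX ⊓ E.geom, PiX ⊓ E.geom⁆ ⊔
      Subgroup.closure ((fun y : E.arith => y ^ l) '' (PiX ⊓ E.geom : Set E.arith))).topologicalClosure
  /-- the cusps of `X̲`, with representative decomposition groups inside `Π_X̲` -/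
  Cusp : Type u
  decomp : Cusp → Subgroup E.arith
  decomp_le : ∀ x, decomp x ≤ PiX ⊓ PiCbar
  /-- `ε⁰`; `ε′ ≠ ε″` over `ε̲`; a cusp over `2ε̲` (distinct from these: `2 ≢ 0, ±1 (mod l)`), whose
  decomposition group surjects onto `G_k` (p. 38: it "determines a section `σ : G_k → J_C`") -/
  ε0 : Cusp
  ε1 : Cusp
  ε2 : Cusp
  twoε : Cusp
  ε1_ne_ε0 : ε1 ≠ ε0
  ε2_ne_ε0 : ε2 ≠ ε0
  ε1_ne_ε2 : ε1 ≠ ε2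
  twoε_ne : twoε ≠ ε0 ∧ twoε ≠ ε1 ∧ twoε ≠ ε2
  aug_decomp_twoε : Function.Surjective (E.aug.toMonoidHom.comp (decomp twoε).subtype)

namespace PuncturedEllipticData

variable (D : PuncturedEllipticData.{u})

/-- `Π_C`, the ambient profinite group. ([IUTchI] §1 p.37) [claim: Mochizuki2012, status: disputed] -/
abbrev PiC : Type u := D.E.arith

/-- `Π_X̲ = Π_X ∩ Π_C̲` (the cartesian diagram of p. 37). ([IUTchI] §1 p.37) [claim: Mochizuki2012,
status: disputed] -/
def PiXbar : Subgroup D.PiC := D.PiX ⊓ D.PiCbar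

/-- `Δ_C = Ker(Π_C ↠ G_k)`. ([IUTchI] §1 p.37) [claim: Mochizuki2012, status: disputed] -/
def DeltaC : Subgroup D.PiC := D.E.geom

/-- `Δ_X̲ = Π_X̲ ∩ Δ_C`. ([IUTchI] §1 p.37) [claim: Mochizuki2012, status: disputed] -/
def DeltaXbar : Subgroup D.PiC := D.PiXbar ⊓ D.DeltaC

/-- `Δ_C̲ = Π_C̲ ∩ Δ_C`. ([IUTchI] §1 p.37) [claim: Mochizuki2012, status: disputed] -/
def DeltaCbar : Subgroup D.PiC := D.PiCbar ⊓ D.DeltaC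

/-- The inertia group `I_x = D_x ∩ Δ_C` of the cusp `x`. ([IUTchI] §1 p.37) [claim: Mochizuki2012,
status: disputed] -/
def inertia (x : D.Cusp) : Subgroup D.PiC := D.decomp x ⊓ D.DeltaC

/-- A cusp of `X̲` is *nonzero* if it is not the zero cusp `ε⁰`. ([IUTchI] §1 p.37) [claim:
Mochizuki2012, status: disputed] -/
def IsNonzeroCusp (x : D.Cusp) : Prop := x ≠ D.ε0

/-! ### The construction of `Π_{X→} ⊆ Π_{C→}` (pp. 37–38) -/

/-- `Ker(Δ_X̲ ↠ Δ_X̲^{ab} ⊗ ℤ/l)`: the closure of the subgroup generated by the commutators and the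
`l`-th powers of `Δ_X̲`. ([IUTchI] §1 p.37) [claim: Mochizuki2012, status: disputed] -/
def modLKer : Subgroup D.PiC :=
  (⁅D.DeltaXbar, D.DeltaXbar⁆ ⊔
    Subgroup.closure ((fun y : D.PiC => y ^ D.l) '' (D.DeltaXbar : Set D.PiC))).topologicalClosure

/-- `Ker(Δ_X̲ ↠ Δ_ε)`: additionally kill the inertia groups of all nonzero cusps `≠ ε′, ε″` of `X̲`
(p. 37). ([IUTchI] §1 p.37) [claim: Mochizuki2012, status: disputed] -/
def deltaEpsKer : Subgroup D.PiC :=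
  D.modLKer ⊔ ⨆ (x : {x : D.Cusp // D.IsNonzeroCusp x ∧ x ≠ D.ε1 ∧ x ≠ D.ε2}), D.inertia x.1

/-- `Ker(Δ_X̲ ↠ Δ_ε ↠ Δ_ε⁺)`: additionally kill the `(−1)`-eigenspace of the involution
`ι ∈ Gal(X̲/C̲)`, which acts on `Δ_ε` through conjugation by any `c ∈ Δ_C̲ ∖ Δ_X̲`; `a − ι(a)` is
the
commutator `x c x⁻¹ c⁻¹` (p. 38: "the action by `ι` on `Δ_ε` determines a decomposition into
eigenspaces `Δ_ε ⥲ Δ_ε⁺ × Δ_ε⁻`"). ([IUTchI] §1 p.38) [claim: Mochizuki2012, status: disputed] -/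
def jKer : Subgroup D.PiC :=
  D.deltaEpsKer ⊔ Subgroup.closure
    {z : D.PiC | ∃ x ∈ D.DeltaXbar, ∃ c ∈ D.DeltaCbar, c ∉ D.DeltaXbar ∧ z = x * c * x⁻¹ * c⁻¹}

/-- `Π_{X→} ⊆ Π_X̲`: the inverse image under `Π_X̲ ↠ J_X = Π_X̲ / jKer` of the image `Im(σ)` of the
section `σ : G_k → J_C` determined by the decomposition group of the cusp `2ε̲`, i.e.
`D_{2ε} · jKer` (p. 38). ([IUTchI] §1 p.38) [claim: Mochizuki2012, status: disputed] -/
def piXarrow : Subgroup D.PiC := D.decomp D.twoε ⊔ D.jKer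

/-- The inverse image in `Δ_C̲` of `Gal(X̲/C̲) ⊆ Δ_C̲ / jKer ≅ Δ_ε⁺ × Gal(X̲/C̲) ≅ ℤ/l × ℤ/2` (p.
38): the
order-`2` part of a cyclic group of order `2l` is its subgroup of `l`-th powers.
([IUTchI] §1 p.38) [claim: Mochizuki2012, status: disputed] -/
def galKer : Subgroup D.PiC :=
  D.jKer ⊔ Subgroup.closure ((fun y : D.PiC => y ^ D.l) '' (D.DeltaCbar : Set D.PiC))

/-- `Π_{C→} ⊆ Π_C̲`: the inverse image under `Π_C̲ ↠ J_C` of `Im(σ) × Gal(X̲/C̲)` (p. 38), i.e.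
`D_{2ε} · jKer · (Δ_C̲)^l`. ([IUTchI] §1 p.38) [claim: Mochizuki2012, status: disputed] -/
def piCarrow : Subgroup D.PiC := D.decomp D.twoε ⊔ D.galKer

/-- `Π_{X→} ⊆ Π_{C→}` (the cartesian diagram of p. 38, one inclusion by construction).
([IUTchI] §1 p.38) [claim: Mochizuki2012, status: disputed] -/
theorem piXarrow_le_piCarrow : D.piXarrow ≤ D.piCarrow :=
  sup_le_sup_left le_sup_left _

/-- **The printed claims of pp. 37–38** about the construction, for the data `D` (a predicate, not
asserted): `jKer` is normal in `Π_C̲` [the quotients `J_X ⊆ J_C` exist] with `Δ_X̲ / jKer = Δ_ε⁺` of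
order `l` and `I_{ε′} ⥲ Δ_ε⁺`, `I_{ε″} ⥲ Δ_ε⁺`; `σ` is a section [`Π_{X→} ∩ Δ_C = jKer`,
`Π_{X→} ↠ G_k`]; the diagram is cartesian [`Π_{X→} = Π_X̲ ∩ Π_{C→}`] with normal images and
`Gal(C→/C̲) ≅ ℤ/l`, `Gal(X→/C̲) ≅ ℤ/2l` [indices `l`, `2l`, cyclic quotients].
([IUTchI] §1 p.38) [claim: Mochizuki2012, status: disputed] -/
structure ArrowCoveringClaims : Prop where
  jKer_normal : (D.jKer.subgroupOf D.PiCbar).Normal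
  jKer_relindex : D.jKer.relIndex D.DeltaXbar = D.l
  inertia_ε1_sup : D.inertia D.ε1 ⊔ D.jKer = D.DeltaXbar
  inertia_ε2_sup : D.inertia D.ε2 ⊔ D.jKer = D.DeltaXbar
  piXarrow_inf_delta : D.piXarrow ⊓ D.DeltaC = D.jKer
  aug_piXarrow : Function.Surjective (D.E.aug.toMonoidHom.comp D.piXarrow.subtype)
  cartesian : D.piXarrow = D.PiXbar ⊓ D.piCarrow
  piXarrow_normal : (D.piXarrow.subgroupOf D.PiCbar).Normal
  piCarrow_normal : (D.piCarrow.subgroupOf D.PiCbar).Normal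
  piXarrow_relindex : D.piXarrow.relIndex D.PiCbar = 2 * D.l
  piCarrow_relindex : D.piCarrow.relIndex D.PiCbar = D.l
  galX_cyclic : ∀ [(D.piXarrow.subgroupOf D.PiCbar).Normal],
    IsCyclic (D.PiCbar ⧸ D.piXarrow.subgroupOf D.PiCbar)
  galC_cyclic : ∀ [(D.piCarrow.subgroupOf D.PiCbar).Normal],
    IsCyclic (D.PiCbar ⧸ D.piCarrow.subgroupOf D.PiCbar)

end PuncturedEllipticData

/-! ### Definition 1.1 (p. 38), group-level -/

section Definition11

/-- **Definition 1.1** (p. 38), GROUP-LEVEL SHADOW: an extension `A = (Π_A ↠ G_A)` "is [the arithmetic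
fundamental group of a hyperbolic orbicurve over `k`] of type `(1,l-tors→)`" if it is isomorphic,
over an isomorphism of Galois groups `G_A ⥲ G_k`, to `Π_{X→} ⊆ Π_C ↠ G_k` for some data
`(l, X/k, C̲, ε̲)`.  [The printed definition is about orbicurves: "a hyperbolic orbicurve over `k`
that arises, up to isomorphism, as `X→` … for some choice of `l`, `ε̲`"; the orbicurve `X→` is the
finite étale covering of `C` corresponding to the open subgroup `Π_{X→}` — TODO-merge:abc-iut-L4-t1.]
([IUTchI] Def 1.1 p.38) [claim: Mochizuki2012, status: disputed] -/
def IsOfTypeOneLTorsArrow (A : FundamentalExtension.{u}) : Prop :=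
  ∃ (D : PuncturedEllipticData.{u}) (e : A.arith ≃* D.piXarrow) (g : A.gal ≃* D.E.gal),
    Continuous e ∧ Continuous e.symm ∧ Continuous g ∧
    ∀ x : A.arith, D.E.aug (e x : D.PiC) = g (A.aug x)

/-- **Definition 1.1** (p. 38), GROUP-LEVEL SHADOW, the "resp." case: type `(1,l-tors→)_±`, i.e.
isomorphic over `G_A ⥲ G_k` to `Π_{C→} ⊆ Π_C ↠ G_k` for some data.
([IUTchI] Def 1.1 p.38) [claim: Mochizuki2012, status: disputed] -/
def IsOfTypeOneLTorsArrowPM (A : FundamentalExtension.{u}) : Prop :=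
  ∃ (D : PuncturedEllipticData.{u}) (e : A.arith ≃* D.piCarrow) (g : A.gal ≃* D.E.gal),
    Continuous e ∧ Continuous e.symm ∧ Continuous g ∧
    ∀ x : A.arith, D.E.aug (e x : D.PiC) = g (A.aug x)

end Definition11

/-! ### Corollary 1.2 and Remark 1.2.1 (pp. 39–40) -/

namespace PuncturedEllipticData

variable (D D' : PuncturedEllipticData.{u})

/-- The conjugacy classes [in `Π_X̲`] of decomposition groups determined by the set of cusps
`{ε′, ε″}`, as a set of subgroups of `Π_C̲`. ([IUTchI] Cor 1.2 p.39) [claim: Mochizuki2012, status: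
disputed] -/
def cuspClassX : Set (Subgroup D.PiCbar) :=
  {K | ∃ t ∈ D.PiXbar.subgroupOf D.PiCbar, ∃ e : D.Cusp, (e = D.ε1 ∨ e = D.ε2) ∧
    K = MulAut.conj t • (D.decomp e).subgroupOf D.PiCbar}

/-- The conjugacy class [in `Π_C̲`] of decomposition groups determined by the cusp `ε̲` of `C̲`
[represented by `D_{ε′}`; `ε̲` is not an orbifold point]. ([IUTchI] Cor 1.2 p.39) [claim:
Mochizuki2012, status: disputed] -/
def cuspClassC : Set (Subgroup D.PiCbar) :=
  {K | ∃ t : D.PiCbar, K = MulAut.conj t • (D.decomp D.ε1).subgroupOf D.PiCbar}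

/-- **Corollary 1.2 (Characteristic Nature of Coverings)**, p. 39, for a pair of data `D`, `D'`
[over NF's or MLF's `k`, `k'`], EXTENSIONAL FORM of "there exists a functorial group-theoretic
algorithm to reconstruct `Π_X̲, Π_{C→}, Π_C̲` (resp. `Π_C̲`) together with the conjugacy classes of
the
decomposition groups of `{ε′, ε″}`, `{ε̲}` (resp. `{ε̲}`) from `Π_{X→}` (resp. `Π_{C→}`),
functorially with
respect to isomorphisms of topological groups, as subgroups of `Aut(Π_{X→})` (resp. `Aut(Π_{C→})`)":
every bi-continuous isomorphism `Π_{X→} ⥲ Π'_{X→}` extends to an isomorphism `Π_C̲ ⥲ Π'_C̲` carrying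
`Π_X̲, Π_{C→}` and the two cusp classes to their primed counterparts; and likewise for `Π_{C→}`.  A
predicate, not asserted. ([IUTchI] Cor 1.2 p.39) [claim: Mochizuki2012, status: disputed] -/
structure CharacteristicNatureOfCoverings : Prop where
  ofXarrow : ∀ φ : D.piXarrow ≃* D'.piXarrow, Continuous φ → Continuous φ.symm →
    ∃ Φ : D.PiCbar ≃* D'.PiCbar, Continuous Φ ∧
      (∀ (x : D.PiC) (hx : x ∈ D.piXarrow) (hx' : x ∈ D.PiCbar),
        (Φ ⟨x, hx'⟩ : D'.PiC) = (φ ⟨x, hx⟩ : D'.PiC)) ∧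
      (D.PiXbar.subgroupOf D.PiCbar).map Φ.toMonoidHom = D'.PiXbar.subgroupOf D'.PiCbar ∧
      (D.piCarrow.subgroupOf D.PiCbar).map Φ.toMonoidHom = D'.piCarrow.subgroupOf D'.PiCbar ∧
      Subgroup.map Φ.toMonoidHom '' D.cuspClassX = D'.cuspClassX ∧
      Subgroup.map Φ.toMonoidHom '' D.cuspClassC = D'.cuspClassC
  ofCarrow : ∀ ψ : D.piCarrow ≃* D'.piCarrow, Continuous ψ → Continuous ψ.symm →
    ∃ Ψ : D.PiCbar ≃* D'.PiCbar, Continuous Ψ ∧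
      (∀ (x : D.PiC) (hx : x ∈ D.piCarrow) (hx' : x ∈ D.PiCbar),
        (Ψ ⟨x, hx'⟩ : D'.PiC) = (ψ ⟨x, hx⟩ : D'.PiC)) ∧
      Subgroup.map Ψ.toMonoidHom '' D.cuspClassC = D'.cuspClassC

/-- **Remark 1.2.1**, p. 40, for the data `D`: `Aut_k(X→) = Gal(X→/C̲) (≅ ℤ/2lℤ)`,
`Aut_k(C→) = Gal(C→/C̲) (≅ ℤ/lℤ)`.  GROUP-LEVEL rendering: since `C` is a `k`-core of `X→` and `C→`,
`Aut_k(X→) = N_{Π_C}(Π_{X→}) / Π_{X→}`, so the Remark says that the normalisers of `Π_{X→}`,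
`Π_{C→}` in
`Π_C` are `Π_C̲`, with cyclic quotients of orders `2l`, `l` (cf. `ArrowCoveringClaims`).  A
predicate,
not asserted. ([IUTchI] Rmk 1.2.1 p.40) [claim: Mochizuki2012, status: disputed] -/
structure Rmk121 : Prop where
  normalizer_piXarrow : Subgroup.normalizer (D.piXarrow : Set D.PiC) = D.PiCbar
  normalizer_piCarrow : Subgroup.normalizer (D.piCarrow : Set D.PiC) = D.PiCbar
  card_galX : D.piXarrow.relIndex D.PiCbar = 2 * D.l
  card_galC : D.piCarrow.relIndex D.PiCbar = D.l

end PuncturedEllipticData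

/-! ### Remark 1.2.3 (iii), last sentence (p. 41) -/

/-- **Remark 1.2.3 (iii)**, p. 41, last sentence (PROVED): for a `Π^unr_𝔾`-covering `𝔾′ → 𝔾` [so
`n(𝔾′) = deg(𝔾′/𝔾) · n(𝔾)`], the equality `i(𝔾′) = deg(𝔾′/𝔾) · (i(𝔾) − 1) + 1` "is equivalent to the
following equality involving the expression '`i(…) − n(…)`'":
`i(𝔾′) − n(𝔾′) = deg(𝔾′/𝔾) · (i(𝔾) − n(𝔾) − 1) + 1`.  [The characterisations of cuspidally /
verticially
purely totally ramified coverings that this sentence follows belong with [CombGC] Rmk. 1.4.2.]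
([IUTchI] Rmk 1.2.3(iii) p.41) [claim: Mochizuki2012, status: disputed] -/
theorem rmk123iii_equalities_iff (d i i' n n' : ℤ) (hn : n' = d * n) :
    i' = d * (i - 1) + 1 ↔ i' - n' = d * (i - n - 1) + 1 := by
  subst hn
  constructor
  · intro h; rw [h]; ring
  · intro h; linarith [h]

end Literature.IUT.HodgeTheaters
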